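import Summits.AtomisticToContinuum.BoseEinsteinCondensation.Theorems.BECConjugateDominationHardCoreExtensionAlphaPhys
import Summits.AtomisticToContinuum.BoseEinsteinCondensation.Theorems.BECConjugateDominationHardCoreExtensionPairCutoff
import HarnessLib

/-!
# (α'_soft): `E₀(min(v,n)) ↑ E₀(v)` for SOFT CORES — the cut-off argument with a variable core radius `δ → 0`
# — line `third-law-current-floor`, crux `HardCoreExtension` (stmt-AtomisticToContinuum-11786), lead c1

Registered composition node `stub_truncationEnergyConvergenceSoft_of`: (E2U pair cut-off, constant uniform in the core radius
`a ≤ a₀`) → (P3 kinetic tightness) → (P4U shell mass bound, uniform constant) → for every admissible `v` of the SOFT-CORE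
CLASS with inner radius `a ≥ 0` at scale `a₀` (`∀ δ ∈ (0,a₀], v` bounded on `(a+δ,∞)`; `∀ C ∀ δ₁ > 0 ∃ δ ≤ min(a₀,δ₁),
`v ≥ C/δ²` on `[0,a+δ)` — e.g. soft cores `v ≍ r^{-p}`, `p > 2` (`a = 0`), hard core `[0,a)` + tail blowing up at `a⁺`; not Coulomb-type
`p ≤ 2`, not hard core + bounded tail, which is `…AlphaPhys.lean`), every `N`, `L > 4(a+a₀)`,
`E₀(v,N,L) < ⊤`, `ε > 0`: `∃ n₀ ∀ n ≥ n₀, E₀(v) ≤ E₀(min(v,n)) + ε`. Proof = (α'_phys) with `δ` chosen AFTER `ε`: the layers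
around the wall at radius `a` shrink to it (null), P3 gives `k₀`; `δ ≤ 1/(2(k₀+1))` with `v ≥ C_big/δ²` on `[0,a+δ)` penalises
the core mass and beats the shell error `(C/δ²)·(shell mass)`; cut radius `a + δ`, shell width `ℓ = δ`. [folklore]
-/

noncomputable section

namespace Summit.AtomisticToContinuum.BoseEinsteinCondensation.Cruxes.HardCoreExtension.ThirdLawCurrentFloor

open MeasureTheory Filter
open scoped ENNReal NNReal BigOperators Topology
open Literature.MathematicalPhysics.QuantumManyBody.BoseGas
open Summit.AtomisticToContinuum.BoseEinsteinCondensation.Theorems.PositiveMinimiser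

namespace AlphaSoft

open AlphaPhys

variable {N : ℕ} {L : ℝ}

/-- **Core mass under a quantitative repulsion**: `v ≥ V` on `[0,δ)`, `V ≤ m` ⇒ `V·(core mass) ≤ 𝓔_{min(v,m)}[Ψ]`. [folklore] -/
theorem ofReal_mul_coreMass_le_energy {v : ℝ → ℝ≥0∞} {δ V : ℝ} {m : ℕ}
    (hcore : ∀ r, 0 ≤ r → r < δ → ENNReal.ofReal V ≤ v r) (hVm : ENNReal.ofReal V ≤ (m : ℝ≥0∞))
    (Ψ : PeriodicTrialState N L) :
    ENNReal.ofReal V * ∫⁻ X in {X : Config N | ∃ i j : Fin N, i ≠ j ∧ ∃ n : Fin 3 → ℤ,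
        ‖X i - X j - latticeVec L n‖ < δ} ∩ cellN N L, (‖Ψ.ψ X‖₊ : ℝ≥0∞) ^ 2 ≤
      periodicEnergy (fun r => min (v r) (m : ℝ≥0∞)) Ψ := by
  set K : Set (Config N) := {X : Config N | ∃ i j : Fin N, i ≠ j ∧ ∃ n : Fin 3 → ℤ,
      ‖X i - X j - latticeVec L n‖ < δ} with hK
  rw [← lintegral_const_mul' _ _ ENNReal.ofReal_ne_top]
  calc ∫⁻ X in K ∩ cellN N L, ENNReal.ofReal V * (‖Ψ.ψ X‖₊ : ℝ≥0∞) ^ 2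
      ≤ ∫⁻ X in K ∩ cellN N L, kineticDensity Ψ.ψ X +
          periodicInteraction (fun r => min (v r) (m : ℝ≥0∞)) L X * (‖Ψ.ψ X‖₊ : ℝ≥0∞) ^ 2 := by
        refine setLIntegral_mono' ((measurableSet_pairImage (S := Set.Iio δ) L measurableSet_Iio).inter
          (measurableSet_cellN N L)) fun X hX => ?_
        obtain ⟨i, j, hij, n, hn⟩ := hX.1
        have hW : ENNReal.ofReal V ≤ periodicInteraction (fun r => min (v r) (m : ℝ≥0∞)) L X :=
          calc ENNReal.ofReal V ≤ min (v ‖X i - X j - latticeVec L n‖) (m : ℝ≥0∞) :=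
                le_min (hcore _ (norm_nonneg _) hn) hVm
            _ ≤ _ := apply_le_periodicInteraction (fun r => min (v r) (m : ℝ≥0∞)) L X hij n
        exact (mul_le_mul' hW le_rfl).trans le_add_self
    _ ≤ periodicEnergy (fun r => min (v r) (m : ℝ≥0∞)) Ψ := by
        unfold periodicEnergy
        exact lintegral_mono_set Set.inter_subset_right

/-- The `ε`-bookkeeping in `ℝ≥0∞` with a REAL penalisation level `V` (in (α'_phys): the truncation height). [folklore] -/
theorem bookkeeping_ennreal_ofReal {B Em q μ mK mO mI Kl : ℝ≥0∞} {θ Cs C ℓ a ε ε₁ V : ℝ}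
    (hB : B ≠ ⊤) (hEmB : Em ≤ B) (hθ : 0 < θ) (hCs : 0 ≤ Cs) (hC : 0 ≤ C) (hℓ : 0 < ℓ) (hℓa : ℓ ≤ a)
    (hV : 0 < V) (hε : 0 < ε) (hε₁ : 0 < ε₁)
    (h1 : B * μ ≤ q) (h2 : 1 ≤ μ + mK + mO) (hμ1 : μ ≤ 1) (hmK1 : mK ≤ 1) (hmO1 : mO ≤ 1)
    (h4 : q ≤ ENNReal.ofReal (1 + θ) * Em + ENNReal.ofReal ((1 + θ⁻¹) * (C / ℓ ^ 2)) * mO)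
    (hcore : ENNReal.ofReal V * mK ≤ Em) (hinner : mI ≤ mK)
    (hshell : mO ≤ ENNReal.ofReal Cs * mI + ENNReal.ofReal (Cs * ℓ ^ 2) * Kl) (hKl : Kl ≤ ENNReal.ofReal ε₁)
    (hθε : θ * (B.toReal + 1) * 6 ≤ ε) (hε₁a : ε₁ * (Cs + 1) * (B.toReal + 1) * a ^ 2 * 6 ≤ ε)
    (hε₁b : ε₁ * (C * Cs + 1) * (1 + θ) * 6 ≤ ε * θ)
    (hm1 : (1 + Cs) * (B.toReal ^ 2 + 1) * 6 ≤ ε * V)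
    (hm2 : (1 + θ) * C * Cs * (B.toReal + 1) * 6 ≤ ε * θ * ℓ ^ 2 * V) :
    B ≤ Em + ENNReal.ofReal ε := by
  have hEm : Em ≠ ⊤ := ne_top_of_le_ne_top hB hEmB
  have hμ : μ ≠ ⊤ := ne_top_of_le_ne_top ENNReal.one_ne_top hμ1
  have hmK : mK ≠ ⊤ := ne_top_of_le_ne_top ENNReal.one_ne_top hmK1
  have hmO : mO ≠ ⊤ := ne_top_of_le_ne_top ENNReal.one_ne_top hmO1
  have hmI : mI ≠ ⊤ := ne_top_of_le_ne_top hmK hinner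
  have hKl' : Kl ≠ ⊤ := ne_top_of_le_ne_top ENNReal.ofReal_ne_top hKl
  have h4top : ENNReal.ofReal (1 + θ) * Em + ENNReal.ofReal ((1 + θ⁻¹) * (C / ℓ ^ 2)) * mO ≠ ⊤ :=
    ENNReal.add_ne_top.2 ⟨ENNReal.mul_ne_top ENNReal.ofReal_ne_top hEm,
      ENNReal.mul_ne_top ENNReal.ofReal_ne_top hmO⟩
  have hq : q ≠ ⊤ := ne_top_of_le_ne_top h4top h4
  have hshtop : ENNReal.ofReal Cs * mI + ENNReal.ofReal (Cs * ℓ ^ 2) * Kl ≠ ⊤ :=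
    ENNReal.add_ne_top.2 ⟨ENNReal.mul_ne_top ENNReal.ofReal_ne_top hmI,
      ENNReal.mul_ne_top ENNReal.ofReal_ne_top hKl'⟩
  have hA : 0 ≤ (1 + θ⁻¹) * (C / ℓ ^ 2) := by positivity
  have r1 : B.toReal * μ.toReal ≤ q.toReal := by
    rw [← ENNReal.toReal_mul]; exact ENNReal.toReal_mono hq h1
  have r2 : 1 ≤ μ.toReal + mK.toReal + mO.toReal := by
    have := ENNReal.toReal_mono (ENNReal.add_ne_top.2 ⟨ENNReal.add_ne_top.2 ⟨hμ, hmK⟩, hmO⟩) h2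
    rwa [ENNReal.toReal_add (ENNReal.add_ne_top.2 ⟨hμ, hmK⟩) hmO, ENNReal.toReal_add hμ hmK,
      ENNReal.toReal_one] at this
  have r4 : q.toReal ≤ (1 + θ) * Em.toReal + (1 + θ⁻¹) * (C / ℓ ^ 2) * mO.toReal := by
    have := ENNReal.toReal_mono h4top h4
    rwa [ENNReal.toReal_add (ENNReal.mul_ne_top ENNReal.ofReal_ne_top hEm)
      (ENNReal.mul_ne_top ENNReal.ofReal_ne_top hmO), ENNReal.toReal_mul, ENNReal.toReal_mul,
      ENNReal.toReal_ofReal (by positivity), ENNReal.toReal_ofReal hA] at this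
  have rcore : V * mK.toReal ≤ Em.toReal := by
    have := ENNReal.toReal_mono hEm hcore
    rwa [ENNReal.toReal_mul, ENNReal.toReal_ofReal hV.le] at this
  have rinner : mI.toReal ≤ mK.toReal := ENNReal.toReal_mono hmK hinner
  have rshell : mO.toReal ≤ Cs * mI.toReal + Cs * ℓ ^ 2 * Kl.toReal := by
    have := ENNReal.toReal_mono hshtop hshell
    rwa [ENNReal.toReal_add (ENNReal.mul_ne_top ENNReal.ofReal_ne_top hmI)
      (ENNReal.mul_ne_top ENNReal.ofReal_ne_top hKl'), ENNReal.toReal_mul, ENNReal.toReal_mul,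
      ENNReal.toReal_ofReal hCs, ENNReal.toReal_ofReal (by positivity)] at this
  have rKl : Kl.toReal ≤ ε₁ := ENNReal.toReal_le_of_le_ofReal hε₁.le hKl
  have rEm : Em.toReal ≤ B.toReal := ENNReal.toReal_mono hB hEmB
  have key : B.toReal ≤ Em.toReal + ε :=
    bookkeeping ENNReal.toReal_nonneg rEm hθ hCs hC hℓ hℓa hV hε₁.le r1 r2 r4 (rcore.trans rEm) rinner rshell rKl
      hθε hε₁a hε₁b hm1 hm2
  calc B = ENNReal.ofReal B.toReal := (ENNReal.ofReal_toReal hB).symm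
    _ ≤ ENNReal.ofReal (Em.toReal + ε) := ENNReal.ofReal_le_ofReal key
    _ = Em + ENNReal.ofReal ε := by
        rw [ENNReal.ofReal_add ENNReal.toReal_nonneg hε.le, ENNReal.ofReal_toReal hEm]

/-! ### The assembly -/

/-- **(α'_soft) from the four inputs** (E2U, P3, P4U, positive minimisers of the bounded class): for an admissible `v` of the
soft-core class with inner radius `a ≥ 0` at scale `a₀`, every `N`, `L > 4(a+a₀)` with `E₀(v,N,L) < ⊤` and `ε > 0`:
`E₀(v) ≤ E₀(min(v,n)) + ε` for all large `n`. [folklore] -/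
theorem alphaSoft_of
    (hcutU : ∀ (N : ℕ) (L a₀ : ℝ), 0 < L → 0 < a₀ → ∃ C : ℝ, 0 ≤ C ∧ ∀ a ℓ : ℝ, 0 < ℓ → ℓ ≤ a → a ≤ a₀ →
      ∃ χ : Config N → ℝ, ContDiff ℝ 1 χ ∧
        (∀ (X : Config N) (i : Fin N) (k : Fin 3),
          χ (X + Pi.single i (EuclideanSpace.single k L)) = χ X) ∧
        (∀ (σ : Equiv.Perm (Fin N)) (X : Config N), χ (X ∘ σ) = χ X) ∧
        (∀ X, 0 ≤ χ X ∧ χ X ≤ 1) ∧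
        (∀ X : Config N, (∃ i j : Fin N, i ≠ j ∧ ∃ n : Fin 3 → ℤ, ‖X i - X j - latticeVec L n‖ ≤ a) →
          χ X = 0) ∧
        (∀ X : Config N, (∀ i j : Fin N, i ≠ j → ∀ n : Fin 3 → ℤ, a + ℓ ≤ ‖X i - X j - latticeVec L n‖) →
          χ X = 1) ∧
        (∀ X : Config N, kineticDensity (fun Y => (χ Y : ℂ)) X ≤ ENNReal.ofReal (C / ℓ ^ 2)) ∧
        (∀ X : Config N, (∀ i j : Fin N, i ≠ j → ∀ n : Fin 3 → ℤ,
            ‖X i - X j - latticeVec L n‖ ≤ a ∨ a + ℓ ≤ ‖X i - X j - latticeVec L n‖) →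
          kineticDensity (fun Y => (χ Y : ℂ)) X = 0))
    (htight : ∀ (v : ℝ → ℝ≥0∞), Measurable v → ∀ (N : ℕ) (L : ℝ), 0 < L → ∀ B : ℝ≥0∞, B ≠ ⊤ →
      ∀ Ψ : ℕ → PeriodicTrialState N L,
        (∀ n : ℕ, periodicEnergy (fun r => min (v r) (n : ℝ≥0∞)) (Ψ n) =
          periodicGroundStateEnergy (fun r => min (v r) (n : ℝ≥0∞)) N L) →
        (∀ n : ℕ, periodicEnergy (fun r => min (v r) (n : ℝ≥0∞)) (Ψ n) ≤ B) →
        ∃ φ : ℕ → ℕ, StrictMono φ ∧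
          ∀ S : ℕ → Set (Config N), (∀ k, MeasurableSet (S k)) → Antitone S →
            volume ((⋂ k, S k) ∩ cellN N L) = 0 →
            ∀ ε : ℝ, 0 < ε → ∃ k₀ i₀ : ℕ, ∀ k i : ℕ, k₀ ≤ k → i₀ ≤ i →
              ∫⁻ X in S k ∩ cellN N L, kineticDensity (Ψ (φ i)).ψ X ≤ ENNReal.ofReal ε)
    (hshellU : ∀ (N : ℕ) (L a₀ : ℝ), 0 < L → 0 < a₀ → 4 * a₀ < L → ∃ C : ℝ, 0 ≤ C ∧
      ∀ a ℓ : ℝ, 0 < ℓ → ℓ ≤ a → a ≤ a₀ →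
      ∀ Ψ : Config N → ℂ, ContDiff ℝ 1 Ψ →
        (∀ (X : Config N) (i : Fin N) (k : Fin 3), Ψ (X + Pi.single i (EuclideanSpace.single k L)) = Ψ X) →
        ∫⁻ X in {X : Config N | ∃ i j : Fin N, i ≠ j ∧ ∃ n : Fin 3 → ℤ,
            a < ‖X i - X j - latticeVec L n‖ ∧ ‖X i - X j - latticeVec L n‖ < a + ℓ} ∩ cellN N L,
            (‖Ψ X‖₊ : ℝ≥0∞) ^ 2 ≤
          ENNReal.ofReal C *
              (∫⁻ X in {X : Config N | ∃ i j : Fin N, i ≠ j ∧ ∃ n : Fin 3 → ℤ,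
                  a - ℓ < ‖X i - X j - latticeVec L n‖ ∧ ‖X i - X j - latticeVec L n‖ ≤ a} ∩ cellN N L,
                  (‖Ψ X‖₊ : ℝ≥0∞) ^ 2) +
            ENNReal.ofReal (C * ℓ ^ 2) *
              ∫⁻ X in {X : Config N | ∃ i j : Fin N, i ≠ j ∧ ∃ n : Fin 3 → ℤ,
                  a - ℓ < ‖X i - X j - latticeVec L n‖ ∧ ‖X i - X j - latticeVec L n‖ < a + ℓ} ∩ cellN N L,
                  kineticDensity Ψ X)
    (hPM : ∀ v : ℝ → ℝ≥0∞, IsRepulsiveFiniteRange v → (∃ M : ℝ≥0∞, M ≠ ⊤ ∧ ∀ r, v r ≤ M) →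
      ∀ (n : ℕ) (L : ℝ), 0 < L → ∃ Ψ : PeriodicTrialState (n + 1) L,
        periodicEnergy v Ψ = periodicGroundStateEnergy v (n + 1) L ∧ periodicEnergy v Ψ ≠ ⊤ ∧
        (∀ X, Ψ.ψ X = (‖Ψ.ψ X‖ : ℂ)) ∧ (∀ X, Ψ.ψ X ≠ 0)) :
    ∀ (v : ℝ → ℝ≥0∞) (a a₀ : ℝ), IsRepulsiveFiniteRange v → 0 ≤ a → 0 < a₀ →
      (∀ δ : ℝ, 0 < δ → δ ≤ a₀ → ∃ M : ℝ≥0∞, M ≠ ⊤ ∧ ∀ r, a + δ < r → v r ≤ M) →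
      (∀ (C δ₁ : ℝ), 0 < δ₁ → ∃ δ : ℝ, 0 < δ ∧ δ ≤ δ₁ ∧ δ ≤ a₀ ∧
        ∀ r, 0 ≤ r → r < a + δ → ENNReal.ofReal (C / δ ^ 2) ≤ v r) →
      ∀ (N : ℕ) (L : ℝ), 4 * (a + a₀) < L → periodicGroundStateEnergy v N L ≠ ⊤ →
      ∀ ε : ℝ, 0 < ε → ∃ n₀ : ℕ, ∀ n : ℕ, n₀ ≤ n →
        periodicGroundStateEnergy v N L ≤
          periodicGroundStateEnergy (fun r => min (v r) (n : ℝ≥0∞)) N L + ENNReal.ofReal ε := by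
  intro v a a₀ hv ha ha₀ htail hsoft N L h4a hB ε hε
  have hL : 0 < L := by linarith
  have haa₀ : 0 < a + a₀ := by linarith
  rcases Nat.eq_zero_or_pos N with hN0 | hNpos
  · subst hN0
    exact ⟨0, fun n _ => by
      rw [periodicGroundStateEnergy_congr_of_isEmpty v (fun r => min (v r) (n : ℝ≥0∞)) L]
      exact le_self_add⟩
  obtain ⟨k, rfl⟩ : ∃ k, N = k + 1 := ⟨N - 1, by omega⟩
  choose Ψ hΨE hΨfin _hΨreal _hΨne using fun n : ℕ =>
    hPM (fun r => min (v r) (n : ℝ≥0∞)) (isRepulsiveFiniteRange_min hv n) (min_bounded v n) k L hL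
  have hEn_le : ∀ n : ℕ, periodicGroundStateEnergy (fun r => min (v r) (n : ℝ≥0∞)) (k + 1) L ≤
      periodicGroundStateEnergy v (k + 1) L := fun n =>
    periodicGroundStateEnergy_mono_of_le (fun r => min_le_left _ _)
  have hΨB : ∀ n : ℕ, periodicEnergy (fun r => min (v r) (n : ℝ≥0∞)) (Ψ n) ≤
      periodicGroundStateEnergy v (k + 1) L := fun n => (hΨE n).le.trans (hEn_le n)
  obtain ⟨φ, hφ, hT⟩ := htight v hv.1 (k + 1) L hL _ hB Ψ hΨE hΨB
  set S : ℕ → Set (Config (k + 1)) := fun kk => {X : Config (k + 1) | ∃ i j : Fin (k + 1), i ≠ j ∧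
      ∃ n : Fin 3 → ℤ, a - 1 / ((kk : ℝ) + 1) < ‖X i - X j - latticeVec L n‖ ∧
        ‖X i - X j - latticeVec L n‖ < a + 1 / ((kk : ℝ) + 1)} with hSdef
  have hSm : ∀ kk, MeasurableSet (S kk) := fun kk =>
    measurableSet_pairImage (S := Set.Ioo (a - 1 / ((kk : ℝ) + 1)) (a + 1 / ((kk : ℝ) + 1))) L
      measurableSet_Ioo
  have hSanti : Antitone S := by
    intro k₁ k₂ hk X hX
    obtain ⟨i, j, hij, n, h1, h2⟩ := hX
    have hmono : (1 : ℝ) / ((k₂ : ℝ) + 1) ≤ 1 / ((k₁ : ℝ) + 1) :=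
      one_div_le_one_div_of_le (by positivity) (by exact_mod_cast Nat.succ_le_succ hk)
    exact ⟨i, j, hij, n, by linarith, by linarith⟩
  have hSnull : volume ((⋂ kk, S kk) ∩ cellN (k + 1) L) = 0 := by
    refine measure_mono_null Set.inter_subset_left ?_
    rw [hSdef, iInter_layer_eq_wall hL a]
    exact volume_wall_eq_zero (k + 1) L a
  have hT' := hT S hSm hSanti hSnull
  obtain ⟨Cχ, hCχ0, hcutℓ⟩ := hcutU (k + 1) L (a + a₀) hL haa₀
  obtain ⟨Cs, hCs0, hshellℓ⟩ := hshellU (k + 1) L (a + a₀) hL haa₀ h4a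
  set E : ℝ := (periodicGroundStateEnergy v (k + 1) L).toReal with hEdef
  have hE : 0 ≤ E := ENNReal.toReal_nonneg
  have hE1 : (E + 1) ≠ 0 := by positivity
  set θ : ℝ := ε / (6 * (E + 1)) with hθdef
  have hθ : 0 < θ := by positivity
  have hθε : θ * (E + 1) * 6 ≤ ε := by
    have : θ * (E + 1) * 6 = ε := by rw [hθdef]; field_simp
    exact this.le
  have hθ1 : (1 + θ) ≠ 0 := by positivity
  set ε₁ : ℝ := min (ε / (6 * (Cs + 1) * (E + 1) * (a + a₀) ^ 2)) (ε * θ / (6 * (Cχ * Cs + 1) * (1 + θ)))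
    with hε₁def
  have hε₁ : 0 < ε₁ := lt_min (by positivity) (by positivity)
  have hε₁a : ε₁ * (Cs + 1) * (E + 1) * (a + a₀) ^ 2 * 6 ≤ ε := by
    have h := min_le_left (ε / (6 * (Cs + 1) * (E + 1) * (a + a₀) ^ 2)) (ε * θ / (6 * (Cχ * Cs + 1) * (1 + θ)))
    rw [← hε₁def, le_div_iff₀ (by positivity)] at h
    calc ε₁ * (Cs + 1) * (E + 1) * (a + a₀) ^ 2 * 6 = ε₁ * (6 * (Cs + 1) * (E + 1) * (a + a₀) ^ 2) := by ring
      _ ≤ ε := h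
  have hε₁b : ε₁ * (Cχ * Cs + 1) * (1 + θ) * 6 ≤ ε * θ := by
    have h := min_le_right (ε / (6 * (Cs + 1) * (E + 1) * (a + a₀) ^ 2)) (ε * θ / (6 * (Cχ * Cs + 1) * (1 + θ)))
    rw [← hε₁def, le_div_iff₀ (by positivity)] at h
    calc ε₁ * (Cχ * Cs + 1) * (1 + θ) * 6 = ε₁ * (6 * (Cχ * Cs + 1) * (1 + θ)) := by ring
      _ ≤ ε * θ := h
  obtain ⟨k₀, i₀, hki⟩ := hT' ε₁ hε₁
  -- the penalisation constant `C_big` and the core radius `δ` (= shell width `ℓ`)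
  set R₁ : ℝ := (1 + Cs) * (E ^ 2 + 1) * 6 / ε with hR₁
  set R₂ : ℝ := (1 + θ) * Cχ * Cs * (E + 1) * 6 / (ε * θ) with hR₂
  set Cbig : ℝ := R₁ * a₀ ^ 2 + R₂ + 1 with hCbig
  have hR₁0 : 0 ≤ R₁ := by positivity
  have hR₂0 : 0 ≤ R₂ := by positivity
  have hCbig0 : 0 < Cbig := by positivity
  obtain ⟨δ, hδ, hδk, hδa₀, hcoreδ⟩ := hsoft Cbig (1 / (2 * ((k₀ : ℝ) + 1))) (by positivity)
  obtain ⟨M, hMtop, hM⟩ := htail δ hδ hδa₀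
  have hδR : δ ≤ a + δ := by linarith
  have hRa₀ : a + δ ≤ a + a₀ := by linarith
  obtain ⟨χ, hχ1, hχper, hχsymm, hχ01, hχ0, hχfar1, hχC, hχfar⟩ := hcutℓ (a + δ) δ hδ hδR hRa₀
  set V : ℝ := Cbig / δ ^ 2 with hVdef
  have hV : 0 < V := by positivity
  have hm1 : (1 + Cs) * (E ^ 2 + 1) * 6 ≤ ε * V := by
    have hδ2 : δ ^ 2 ≤ a₀ ^ 2 := pow_le_pow_left₀ hδ.le hδa₀ 2
    have h1 : R₁ * δ ^ 2 ≤ Cbig := by nlinarith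
    have h2 : R₁ ≤ V := by rw [hVdef, le_div_iff₀ (by positivity)]; exact h1
    have h3 : (1 + Cs) * (E ^ 2 + 1) * 6 = ε * R₁ := by rw [hR₁]; field_simp
    rw [h3]; exact mul_le_mul_of_nonneg_left h2 hε.le
  have hm2 : (1 + θ) * Cχ * Cs * (E + 1) * 6 ≤ ε * θ * δ ^ 2 * V := by
    have h1 : ε * θ * δ ^ 2 * V = ε * θ * Cbig := by rw [hVdef]; field_simp
    have h3 : (1 + θ) * Cχ * Cs * (E + 1) * 6 = ε * θ * R₂ := by rw [hR₂]; field_simp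
    rw [h1, h3]
    exact mul_le_mul_of_nonneg_left (by linarith [mul_nonneg hR₁0 (sq_nonneg a₀)]) (by positivity)
  -- the truncation level `m = φ i`: above `M` and above `V`
  set i : ℕ := max i₀ (⌈max M.toReal V⌉₊ + 1) with hidef
  have hi₀ : i₀ ≤ i := le_max_left _ _
  have hiR : max M.toReal V < (i : ℝ) := by
    have h1 : max M.toReal V ≤ (⌈max M.toReal V⌉₊ : ℝ) := Nat.le_ceil _
    have h2 : ((⌈max M.toReal V⌉₊ + 1 : ℕ) : ℝ) ≤ (i : ℝ) := by exact_mod_cast le_max_right _ _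
    push_cast at h2
    linarith
  have him : (i : ℝ) ≤ (φ i : ℝ) := by exact_mod_cast hφ.le_apply
  have hMR := le_max_left M.toReal V
  have hVR := le_max_right M.toReal V
  have hMm : M ≤ ((φ i : ℕ) : ℝ≥0∞) := by
    have h : M.toReal ≤ ((φ i : ℕ) : ℝ) := by linarith
    calc M = ENNReal.ofReal M.toReal := (ENNReal.ofReal_toReal hMtop).symm
      _ ≤ ENNReal.ofReal ((φ i : ℕ) : ℝ) := ENNReal.ofReal_le_ofReal h
      _ = ((φ i : ℕ) : ℝ≥0∞) := ENNReal.ofReal_natCast _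
  have hVm : ENNReal.ofReal V ≤ ((φ i : ℕ) : ℝ≥0∞) := by
    have h : V ≤ ((φ i : ℕ) : ℝ) := by linarith
    calc ENNReal.ofReal V ≤ ENNReal.ofReal ((φ i : ℕ) : ℝ) := ENNReal.ofReal_le_ofReal h
      _ = ((φ i : ℕ) : ℝ≥0∞) := ENNReal.ofReal_natCast _
  -- the cut state `u = χ Ψ_m`
  have hχc1 : ContDiff ℝ 1 (fun Y : Config (k + 1) => (χ Y : ℂ)) := Complex.ofRealCLM.contDiff.comp hχ1
  have hu1 : ContDiff ℝ 1 (fun Y : Config (k + 1) => (χ Y : ℂ) * (Ψ (φ i)).ψ Y) :=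
    hχc1.mul (Ψ (φ i)).contDiff
  have huper : ∀ (X : Config (k + 1)) (i' : Fin (k + 1)) (k' : Fin 3),
      (fun Y : Config (k + 1) => (χ Y : ℂ) * (Ψ (φ i)).ψ Y) (X + Pi.single i' (EuclideanSpace.single k' L)) =
        (fun Y : Config (k + 1) => (χ Y : ℂ) * (Ψ (φ i)).ψ Y) X := fun X i' k' => by
    simp only [hχper X i' k', (Ψ (φ i)).periodic X i' k']
  have husymm : ∀ (σ : Equiv.Perm (Fin (k + 1))) (X : Config (k + 1)),
      (fun Y : Config (k + 1) => (χ Y : ℂ) * (Ψ (φ i)).ψ Y) (X ∘ σ) =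
        (fun Y : Config (k + 1) => (χ Y : ℂ) * (Ψ (φ i)).ψ Y) X := fun σ X => by
    simp only [hχsymm σ X, (Ψ (φ i)).symm σ X]
  have h4E := cutState_form_le (N := k + 1) (L := L) hv.1 hM hMm (Ψ (φ i)) hχ1 hχ01 hχ0 hχC hχfar hθ
  have h2E := (one_le_mass_cutState_add (N := k + 1) (L := L) (Ψ (φ i)) hχfar1).trans
    (add_le_add_left (add_le_add_right (setLIntegral_hardSet_le_open (k + 1) L (a + δ) _) _) _)
  have hμ1 := mass_cutState_le_one (N := k + 1) (L := L) (Ψ (φ i)) hχ01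
  have hμtop : ∫⁻ X in cellN (k + 1) L, ((‖(χ X : ℂ) * (Ψ (φ i)).ψ X‖₊ : ℝ≥0∞)) ^ 2 ≠ ⊤ :=
    ne_top_of_le_ne_top ENNReal.one_ne_top hμ1
  have h1E := GradientCauchy.groundStateEnergy_mul_mass_le_form (N := k + 1) (L := L) v hu1 huper husymm hμtop
  have hcoreE := ofReal_mul_coreMass_le_energy (N := k + 1) (L := L) hcoreδ hVm (Ψ (φ i))
  have hmK1 : ∫⁻ X in {X : Config (k + 1) | ∃ i j : Fin (k + 1), i ≠ j ∧ ∃ n : Fin 3 → ℤ,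
        ‖X i - X j - latticeVec L n‖ < a + δ} ∩ cellN (k + 1) L, ((‖(Ψ (φ i)).ψ X‖₊ : ℝ≥0∞)) ^ 2 ≤ 1 :=
    (lintegral_mono_set Set.inter_subset_right).trans (Ψ (φ i)).norm_eq.le
  have hmO1 : ∫⁻ X in {X : Config (k + 1) | ∃ i j : Fin (k + 1), i ≠ j ∧ ∃ n : Fin 3 → ℤ,
        a + δ < ‖X i - X j - latticeVec L n‖ ∧ ‖X i - X j - latticeVec L n‖ < a + δ + δ} ∩ cellN (k + 1) L,
        ((‖(Ψ (φ i)).ψ X‖₊ : ℝ≥0∞)) ^ 2 ≤ 1 :=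
    (lintegral_mono_set Set.inter_subset_right).trans (Ψ (φ i)).norm_eq.le
  have hinnerE : ∫⁻ X in {X : Config (k + 1) | ∃ i j : Fin (k + 1), i ≠ j ∧ ∃ n : Fin 3 → ℤ,
        a + δ - δ < ‖X i - X j - latticeVec L n‖ ∧ ‖X i - X j - latticeVec L n‖ ≤ a + δ} ∩ cellN (k + 1) L,
        ((‖(Ψ (φ i)).ψ X‖₊ : ℝ≥0∞)) ^ 2 ≤
      ∫⁻ X in {X : Config (k + 1) | ∃ i j : Fin (k + 1), i ≠ j ∧ ∃ n : Fin 3 → ℤ,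
        ‖X i - X j - latticeVec L n‖ < a + δ} ∩ cellN (k + 1) L, ((‖(Ψ (φ i)).ψ X‖₊ : ℝ≥0∞)) ^ 2 := by
    refine le_trans (lintegral_mono_set (Set.inter_subset_inter_left _ ?_))
      (setLIntegral_hardSet_le_open (k + 1) L (a + δ) _)
    rintro X ⟨i', j', hij, n, -, h2⟩
    exact ⟨i', j', hij, n, h2⟩
  have hshellE := hshellℓ (a + δ) δ hδ hδR hRa₀ (Ψ (φ i)).ψ (Ψ (φ i)).contDiff (Ψ (φ i)).periodic
  have hδk' : δ + δ ≤ 1 / ((k₀ : ℝ) + 1) := by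
    have h0 : (0 : ℝ) < (k₀ : ℝ) + 1 := by positivity
    have h := hδk
    rw [le_div_iff₀ (by positivity)] at h
    rw [le_div_iff₀ h0]
    linarith
  have hKlE : ∫⁻ X in {X : Config (k + 1) | ∃ i j : Fin (k + 1), i ≠ j ∧ ∃ n : Fin 3 → ℤ,
        a + δ - δ < ‖X i - X j - latticeVec L n‖ ∧ ‖X i - X j - latticeVec L n‖ < a + δ + δ} ∩ cellN (k + 1) L,
        kineticDensity (Ψ (φ i)).ψ X ≤ ENNReal.ofReal ε₁ := by
    refine le_trans (lintegral_mono_set (Set.inter_subset_inter_left _ ?_)) (hki k₀ i le_rfl hi₀)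
    rintro X ⟨i', j', hij, n, h1, h2⟩
    have : (0 : ℝ) < 1 / ((k₀ : ℝ) + 1) := by positivity
    exact ⟨i', j', hij, n, by linarith, by linarith⟩
  have hEmB : periodicEnergy (fun r => min (v r) ((φ i : ℕ) : ℝ≥0∞)) (Ψ (φ i)) ≤
      periodicGroundStateEnergy v (k + 1) L := hΨB (φ i)
  have key : periodicGroundStateEnergy v (k + 1) L ≤
      periodicEnergy (fun r => min (v r) ((φ i : ℕ) : ℝ≥0∞)) (Ψ (φ i)) + ENNReal.ofReal ε :=
    bookkeeping_ennreal_ofReal hB hEmB hθ hCs0 hCχ0 hδ (hδa₀.trans (by linarith)) hV hε hε₁ h1E h2E hμ1 hmK1 hmO1 h4E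
      hcoreE hinnerE
      hshellE hKlE hθε hε₁a hε₁b hm1 hm2
  rw [hΨE (φ i)] at key
  refine ⟨φ i, fun n hn => key.trans ?_⟩
  have hmn : ((φ i : ℕ) : ℝ≥0∞) ≤ (n : ℝ≥0∞) := by exact_mod_cast hn
  exact add_le_add_left (periodicGroundStateEnergy_mono_of_le fun r => min_le_min_left (v r) hmn) _

end AlphaSoft

/-- **(α'_soft), closed modulo the three classical inputs** — registered composition node of the line
`third-law-current-floor`: the uniform pair cut-off (`stub_pairCutoffExistsUniform`), the kinetic tightness of truncation
minimisers (`stub_truncationMinimisersKineticTightness`) and the uniform pair-shell mass bound (`stub_pairShellMassBoundUniform`)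
imply the truncation energy convergence from below for the SOFT-CORE class with inner radius `a ≥ 0` at scale `a₀` (bounded on
every `(a+δ,∞)`, `v ≥ C/δ²` on `[0,a+δ)` for every `C` at arbitrarily small `δ`: soft cores `r^{-p}`, `p > 2`, `a = 0`; hard
core + tail blowing up at `a⁺`), for every `N`, `L > 4(a+a₀)` of finite energy, `ε > 0`. [folklore] -/
theorem stub_truncationEnergyConvergenceSoft_of :
    (∀ (N : ℕ) (L a₀ : ℝ), 0 < L → 0 < a₀ → ∃ C : ℝ, 0 ≤ C ∧ ∀ a ℓ : ℝ, 0 < ℓ → ℓ ≤ a → a ≤ a₀ →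
      ∃ χ : Config N → ℝ, ContDiff ℝ 1 χ ∧
        (∀ (X : Config N) (i : Fin N) (k : Fin 3),
          χ (X + Pi.single i (EuclideanSpace.single k L)) = χ X) ∧
        (∀ (σ : Equiv.Perm (Fin N)) (X : Config N), χ (X ∘ σ) = χ X) ∧
        (∀ X, 0 ≤ χ X ∧ χ X ≤ 1) ∧
        (∀ X : Config N, (∃ i j : Fin N, i ≠ j ∧ ∃ n : Fin 3 → ℤ, ‖X i - X j - latticeVec L n‖ ≤ a) →
          χ X = 0) ∧
        (∀ X : Config N, (∀ i j : Fin N, i ≠ j → ∀ n : Fin 3 → ℤ, a + ℓ ≤ ‖X i - X j - latticeVec L n‖) →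
          χ X = 1) ∧
        (∀ X : Config N, kineticDensity (fun Y => (χ Y : ℂ)) X ≤ ENNReal.ofReal (C / ℓ ^ 2)) ∧
        (∀ X : Config N, (∀ i j : Fin N, i ≠ j → ∀ n : Fin 3 → ℤ,
            ‖X i - X j - latticeVec L n‖ ≤ a ∨ a + ℓ ≤ ‖X i - X j - latticeVec L n‖) →
          kineticDensity (fun Y => (χ Y : ℂ)) X = 0)) →
    (∀ (v : ℝ → ℝ≥0∞), Measurable v → ∀ (N : ℕ) (L : ℝ), 0 < L → ∀ B : ℝ≥0∞, B ≠ ⊤ →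
      ∀ Ψ : ℕ → PeriodicTrialState N L,
        (∀ n : ℕ, periodicEnergy (fun r => min (v r) (n : ℝ≥0∞)) (Ψ n) =
          periodicGroundStateEnergy (fun r => min (v r) (n : ℝ≥0∞)) N L) →
        (∀ n : ℕ, periodicEnergy (fun r => min (v r) (n : ℝ≥0∞)) (Ψ n) ≤ B) →
        ∃ φ : ℕ → ℕ, StrictMono φ ∧
          ∀ S : ℕ → Set (Config N), (∀ k, MeasurableSet (S k)) → Antitone S →
            volume ((⋂ k, S k) ∩ cellN N L) = 0 →
            ∀ ε : ℝ, 0 < ε → ∃ k₀ i₀ : ℕ, ∀ k i : ℕ, k₀ ≤ k → i₀ ≤ i →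
              ∫⁻ X in S k ∩ cellN N L, kineticDensity (Ψ (φ i)).ψ X ≤ ENNReal.ofReal ε) →
    (∀ (N : ℕ) (L a₀ : ℝ), 0 < L → 0 < a₀ → 4 * a₀ < L → ∃ C : ℝ, 0 ≤ C ∧
      ∀ a ℓ : ℝ, 0 < ℓ → ℓ ≤ a → a ≤ a₀ →
      ∀ Ψ : Config N → ℂ, ContDiff ℝ 1 Ψ →
        (∀ (X : Config N) (i : Fin N) (k : Fin 3), Ψ (X + Pi.single i (EuclideanSpace.single k L)) = Ψ X) →
        ∫⁻ X in {X : Config N | ∃ i j : Fin N, i ≠ j ∧ ∃ n : Fin 3 → ℤ,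
            a < ‖X i - X j - latticeVec L n‖ ∧ ‖X i - X j - latticeVec L n‖ < a + ℓ} ∩ cellN N L,
            (‖Ψ X‖₊ : ℝ≥0∞) ^ 2 ≤
          ENNReal.ofReal C *
              (∫⁻ X in {X : Config N | ∃ i j : Fin N, i ≠ j ∧ ∃ n : Fin 3 → ℤ,
                  a - ℓ < ‖X i - X j - latticeVec L n‖ ∧ ‖X i - X j - latticeVec L n‖ ≤ a} ∩ cellN N L,
                  (‖Ψ X‖₊ : ℝ≥0∞) ^ 2) +
            ENNReal.ofReal (C * ℓ ^ 2) *
              ∫⁻ X in {X : Config N | ∃ i j : Fin N, i ≠ j ∧ ∃ n : Fin 3 → ℤ,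
                  a - ℓ < ‖X i - X j - latticeVec L n‖ ∧ ‖X i - X j - latticeVec L n‖ < a + ℓ} ∩ cellN N L,
                  kineticDensity Ψ X) →
    ∀ (v : ℝ → ℝ≥0∞) (a a₀ : ℝ), IsRepulsiveFiniteRange v → 0 ≤ a → 0 < a₀ →
      (∀ δ : ℝ, 0 < δ → δ ≤ a₀ → ∃ M : ℝ≥0∞, M ≠ ⊤ ∧ ∀ r, a + δ < r → v r ≤ M) →
      (∀ (C δ₁ : ℝ), 0 < δ₁ → ∃ δ : ℝ, 0 < δ ∧ δ ≤ δ₁ ∧ δ ≤ a₀ ∧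
        ∀ r, 0 ≤ r → r < a + δ → ENNReal.ofReal (C / δ ^ 2) ≤ v r) →
      ∀ (N : ℕ) (L : ℝ), 4 * (a + a₀) < L → periodicGroundStateEnergy v N L ≠ ⊤ →
      ∀ ε : ℝ, 0 < ε → ∃ n₀ : ℕ, ∀ n : ℕ, n₀ ≤ n →
        periodicGroundStateEnergy v N L ≤
          periodicGroundStateEnergy (fun r => min (v r) (n : ℝ≥0∞)) N L + ENNReal.ofReal ε :=
  fun hcutU htight hshellU => AlphaSoft.alphaSoft_of hcutU htight hshellU stub_boundedPositiveMinimiserHolds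

end Summit.AtomisticToContinuum.BoseEinsteinCondensation.Cruxes.HardCoreExtension.ThirdLawCurrentFloor

end
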